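import Mathlib

/-!
# Gluing ODE solutions at matching points (solo-blind, (T2) architecture, PLAN §82)

The certified member of the landing family is assembled from THREE pieces: a left tail on
`(-∞, -X₁]` (left-tail lemma), a validated box solution on `[-X₁, X₂]` (interval Krawczyk), and a
right tail on `[X₂, ∞)` (right-tail lemma), whose full states agree at the two matching points.
This file proves the elementary real-analysis fact that makes the assembly a global solution:
solutions of `y' = f t y` on adjacent intervals that agree at the junction glue to a solution with a
two-sided derivative at the junction, and the three-piece corollary.
-/

namespace Summit.AnomalousDissipation.AnomalousDissipation.Theorems

open Set

section Pointwise

variable {E : Type*}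

/-- The glued function: `y₁` up to and including `a`, `y₂` after `a`. -/
noncomputable def glueAt (a : ℝ) (y₁ y₂ : ℝ → E) : ℝ → E := fun t => if t ≤ a then y₁ t else y₂ t

/-- Left of (or at) the junction the glued function is the first piece. -/
theorem glueAt_of_le {a t : ℝ} (y₁ y₂ : ℝ → E) (h : t ≤ a) : glueAt a y₁ y₂ t = y₁ t := by
  simp [glueAt, h]

/-- Right of the junction the glued function is the second piece. -/
theorem glueAt_of_lt {a t : ℝ} (y₁ y₂ : ℝ → E) (h : a < t) : glueAt a y₁ y₂ t = y₂ t := by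
  simp [glueAt, not_le.mpr h]

/-- At the junction the glued function takes the value of the first piece. -/
theorem glueAt_self (a : ℝ) (y₁ y₂ : ℝ → E) : glueAt a y₁ y₂ a = y₁ a := glueAt_of_le y₁ y₂ le_rfl

/-- Three-piece glue: on `(-∞, a]` it is the left piece. -/
theorem glue3_eq_left {a b t : ℝ} (yL yB yR : ℝ → E) (hab : a < b) (ht : t ≤ a) :
    glueAt b (glueAt a yL yB) yR t = yL t := by
  rw [glueAt_of_le _ _ (ht.trans hab.le), glueAt_of_le _ _ ht]

/-- Three-piece glue: on `(a, b]` it is the box piece. -/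
theorem glue3_eq_box {a b t : ℝ} (yL yB yR : ℝ → E) (hat : a < t) (htb : t ≤ b) :
    glueAt b (glueAt a yL yB) yR t = yB t := by
  rw [glueAt_of_le _ _ htb, glueAt_of_lt _ _ hat]

/-- Three-piece glue: on `(b, ∞)` it is the right piece. -/
theorem glue3_eq_right {a b t : ℝ} (yL yB yR : ℝ → E) (hbt : b < t) :
    glueAt b (glueAt a yL yB) yR t = yR t := by
  rw [glueAt_of_lt _ _ hbt]

end Pointwise

section ODE

variable {E : Type*} [NormedAddCommGroup E] [NormedSpace ℝ E]

/-- Two-piece gluing. `y₁` solves `y' = f t y` on `(-∞, a]` (one-sided derivative at `a`), `y₂` on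
`[a, ∞)`, and the states agree at `a`; then the glued function solves the ODE on all of `ℝ` with
genuine (two-sided) derivatives. -/
theorem glueAt_hasDerivAt (f : ℝ → E → E) (y₁ y₂ : ℝ → E) (a : ℝ)
    (h₁ : ∀ t < a, HasDerivAt y₁ (f t (y₁ t)) t)
    (h₁a : HasDerivWithinAt y₁ (f a (y₁ a)) (Iic a) a)
    (h₂a : HasDerivWithinAt y₂ (f a (y₂ a)) (Ici a) a)
    (h₂ : ∀ t, a < t → HasDerivAt y₂ (f t (y₂ t)) t)
    (hmatch : y₁ a = y₂ a) :
    ∀ t, HasDerivAt (glueAt a y₁ y₂) (f t (glueAt a y₁ y₂ t)) t := by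
  intro t
  rcases lt_trichotomy t a with hlt | rfl | hgt
  · -- left of the junction: the glued function agrees with y₁ near t
    have hev : glueAt a y₁ y₂ =ᶠ[nhds t] y₁ := by
      filter_upwards [Iio_mem_nhds hlt] with s hs
      exact glueAt_of_le y₁ y₂ (le_of_lt hs)
    rw [glueAt_of_le y₁ y₂ hlt.le]
    exact (h₁ t hlt).congr_of_eventuallyEq hev
  · -- at the junction: combine the one-sided derivatives
    rw [glueAt_self]
    have hL : HasDerivWithinAt (glueAt t y₁ y₂) (f t (y₁ t)) (Iic t) t := by
      refine h₁a.congr (fun s hs => glueAt_of_le y₁ y₂ hs) (glueAt_self t y₁ y₂)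
    have hR : HasDerivWithinAt (glueAt t y₁ y₂) (f t (y₁ t)) (Ici t) t := by
      have h₂a' : HasDerivWithinAt y₂ (f t (y₁ t)) (Ici t) t := by rw [hmatch]; exact h₂a
      refine h₂a'.congr (fun s hs => ?_) (by rw [glueAt_self, hmatch])
      rcases eq_or_lt_of_le (show t ≤ s from hs) with h | h
      · subst h; rw [glueAt_self, hmatch]
      · exact glueAt_of_lt y₁ y₂ h
    have hU := hL.union hR
    rw [Iic_union_Ici, hasDerivWithinAt_univ] at hU
    exact hU
  · -- right of the junction
    have hev : glueAt a y₁ y₂ =ᶠ[nhds t] y₂ := by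
      filter_upwards [Ioi_mem_nhds hgt] with s hs
      exact glueAt_of_lt y₁ y₂ hs
    rw [glueAt_of_lt y₁ y₂ hgt]
    exact (h₂ t hgt).congr_of_eventuallyEq hev

/-- A solution with two-sided derivatives everywhere has the one-sided derivatives used above. -/
theorem hasDerivWithinAt_Iic_of_hasDerivAt {y : ℝ → E} {y' : E} {a : ℝ} (h : HasDerivAt y y' a) :
    HasDerivWithinAt y y' (Iic a) a := h.hasDerivWithinAt

/-- A two-sided derivative gives the right one-sided derivative. -/
theorem hasDerivWithinAt_Ici_of_hasDerivAt {y : ℝ → E} {y' : E} {a : ℝ} (h : HasDerivAt y y' a) :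
    HasDerivWithinAt y y' (Ici a) a := h.hasDerivWithinAt

/-- Three-piece assembly (left tail · box · right tail). Each piece is given as a function on `ℝ`
solving the ODE with two-sided derivatives on an OPEN neighbourhood of its closed interval (as the
tail lemmas and the validated box solution provide: ODE solutions extend a little past the matching
points), and the states agree at the two matching points `a < b`. The glued function solves the ODE
on `ℝ`, equals the left piece on `(-∞,a]`, the box piece on `(a,b]`, the right piece on `(b,∞)`. -/
theorem glue3_hasDerivAt (f : ℝ → E → E) (yL yB yR : ℝ → E) (a b : ℝ) (hab : a < b)
    (hL : ∀ t ≤ a, HasDerivAt yL (f t (yL t)) t)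
    (hB : ∀ t, a ≤ t → t ≤ b → HasDerivAt yB (f t (yB t)) t)
    (hR : ∀ t, b ≤ t → HasDerivAt yR (f t (yR t)) t)
    (ha : yL a = yB a) (hb : yB b = yR b) :
    ∀ t, HasDerivAt (glueAt b (glueAt a yL yB) yR) (f t (glueAt b (glueAt a yL yB) yR t)) t := by
  -- first glue yL and yB at a: the result solves the ODE on (-∞, b]
  set yLB := glueAt a yL yB with hyLB
  have hLB : ∀ t ≤ b, HasDerivAt yLB (f t (yLB t)) t := by
    -- glue with a modified right piece that solves everywhere is not available, so argue pointwise
    intro t ht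
    rcases lt_trichotomy t a with hlt | rfl | hgt
    · have hev : yLB =ᶠ[nhds t] yL := by
        filter_upwards [Iio_mem_nhds hlt] with s hs; exact glueAt_of_le yL yB (le_of_lt hs)
      rw [hyLB, glueAt_of_le yL yB hlt.le]; exact (hL t hlt.le).congr_of_eventuallyEq hev
    · rw [hyLB, glueAt_self]
      have h1 : HasDerivWithinAt (glueAt t yL yB) (f t (yL t)) (Iic t) t :=
        ((hL t le_rfl).hasDerivWithinAt).congr (fun s hs => glueAt_of_le yL yB hs) (glueAt_self t yL yB)
      have h2 : HasDerivWithinAt (glueAt t yL yB) (f t (yL t)) (Ici t) t := by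
        have hb' : HasDerivWithinAt yB (f t (yL t)) (Ici t) t := by
          rw [ha]; exact (hB t le_rfl hab.le).hasDerivWithinAt
        refine hb'.congr (fun s hs => ?_) (by rw [glueAt_self, ha])
        rcases eq_or_lt_of_le (show t ≤ s from hs) with h | h
        · subst h; rw [glueAt_self, ha]
        · exact glueAt_of_lt yL yB h
      have hU := h1.union h2
      rw [Iic_union_Ici, hasDerivWithinAt_univ] at hU; exact hU
    · have hev : yLB =ᶠ[nhds t] yB := by
        filter_upwards [Ioi_mem_nhds hgt] with s hs; exact glueAt_of_lt yL yB hs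
      rw [hyLB, glueAt_of_lt yL yB hgt]; exact (hB t hgt.le ht).congr_of_eventuallyEq hev
  -- then glue yLB and yR at b
  have hbm : yLB b = yR b := by rw [hyLB, glueAt_of_lt yL yB hab, hb]
  refine glueAt_hasDerivAt f yLB yR b (fun t ht => hLB t ht.le) ((hLB b le_rfl).hasDerivWithinAt)
    ((hR b le_rfl).hasDerivWithinAt) (fun t ht => hR t ht.le) hbm

end ODE

end Summit.AnomalousDissipation.AnomalousDissipation.Theorems
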